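import Summits.RiemannHypothesis.RiemannHypothesis.Theorems.HandoffPrimeShadowFlat
import Summits.RiemannHypothesis.RiemannHypothesis.Theorems.WeilGroundStateGroundStatesConvergeToXiEulerLagrange
import Literature.NumberTheory.LFunctions.WeilBochnerExtension
import HarnessLib

/-!
# HANDOFF — the arithmetic shadow, SHARP unweighting: a Brun–Titchmarsh inequality with constant `1 + o(1)` from a window
# (rh-explicit, TRACK «HANDOFF», seat prove-2 gen4, ATTEMPT-11 §3(e))

HONEST FRAMING. Nothing here bears on RH. `HandoffPrimeShadowFlat.sum_vonMangoldt_window_le` unweighted the two-sided shadow crudely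
(constant `8`). Here the probe and the window are two flat lobes of DIFFERENT radii `r₁ ≤ r₂`: `u = flatLobe k₁ r₁ (L/2)` (narrow) against
`h = flatLobe k₂ r₂ (−L/2)` (wide, flat on radius `ρ₂ = r₂(1 − 1/(k₂+2))`). Their cross kernel `k = u ⋆ h̃` is CONSTANT `= ∫u = r₁M_{k₁}` at
every lag `y` with `|y − L| ≤ ρ₂ − r₁`, so Weil positivity of `u + t·h` for all real `t` (`WeilPositivityOn (L/2 + r₂)`) gives, for every
finite `T ⊆ {n : |log n − L| ≤ ρ₂ − r₁}` and every `τ > 0`,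

`r₁M_{k₁}·Σ_{n∈T} Λ(n)/√n ≤ (e^{L/2} + e^{−L/2})·4r₁r₂e^{r₁/2}e^{r₂/2} + 4r₂M(L/2 − r₂)(r₁N₁ + r₂N₂) + (ℓ₁r₁N₁ + τ²ℓ₂r₂N₂)/(2τ)`

(`sharp_window_sum_le`; `ℓᵢ = log(1/rᵢ) + C_{kᵢ}`, `Nᵢ = ‖flatProfile kᵢ‖₂² ≤ 2`, `M = archGapBound`). Dividing by `r₁M_{k₁}`: the main term is
`(2r₂/(M_{k₁}·w))·e^{(r₁+r₂)/2}` times the expected `(e^{L/2} + e^{−L/2})·2w` on the window of half-width `w = ρ₂ − r₁` — a Brun–Titchmarsh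
CONSTANT `→ 1` as `k₁, k₂ → ∞`, `r₁/r₂ → 0` (`M_k ≥ 2 − 2/(k+2)`) — and with `τ = √(r₁/r₂)` the fluctuation term is
`√(r₂/r₁)·(ℓ₁N₁ + ℓ₂N₂)/(2M_{k₁})`, i.e. `≍ √x·√(r₂/r₁)·log(x/h)` in `Λ`-units: RH-quality for `h ≳ √x log x`, from the window alone.

References: Montgomery–Vaughan (2007) §13.1 (RH form of short-interval bounds), §15.1; Bombieri (2000) §3 (`Bombieri2000Weil`). NO new definitions.
-/

set_option linter.dupNamespace false  -- the mandated namespace repeats `RiemannHypothesis`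

noncomputable section

open Set Filter Complex MeasureTheory Metric Literature.NumberTheory.LFunctions
open Summit.RiemannHypothesis.RiemannHypothesis.Theorems.Handoff
open Summit.RiemannHypothesis.RiemannHypothesis.Theorems.HandoffCapSharp
open scoped Real ComplexConjugate ArithmeticFunction.vonMangoldt

namespace Summit.RiemannHypothesis.RiemannHypothesis.Theorems.HandoffPrimeShadow

variable {k k₁ k₂ : ℕ} {r r₁ r₂ L : ℝ}

/-! ## §1 Flat lobes at a general centre: Mellin norm, mass -/

/-- `‖f̂(s)‖ ≤ e^{(Re s − ½)x₀}·2r·e^{r|Re s − ½|}` for `f = flatLobe k r x₀`. [folklore] -/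
theorem norm_weilMellin_flatLobe_le (hr : 0 < r) (x₀ : ℝ) (s : ℂ) :
    ‖weilMellin (flatLobe k r x₀) s‖ ≤ Real.exp ((s.re - 1 / 2) * x₀) * (2 * r * Real.exp (r * |s.re - 1 / 2|)) := by
  have h0 := norm_weilMellin_flatLobe_zero_le (k := k) hr s
  rw [weilMellin_flatLobe hr 0 s] at h0
  have e0 : cexp ((s - 1 / 2) * ((0 : ℝ) : ℂ)) = 1 := by simp
  rw [e0, one_mul] at h0
  rw [weilMellin_flatLobe hr x₀ s, norm_mul, Complex.norm_exp]
  have hre : ((s - 1 / 2) * (x₀ : ℂ)).re = (s.re - 1 / 2) * x₀ := by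
    simp [Complex.mul_re, Complex.sub_re]
  rw [hre]
  exact mul_le_mul_of_nonneg_left h0 (Real.exp_pos _).le

/-- The translate of the centred lobe is the lobe at the new centre. [folklore] -/
theorem weilTranslate_flatLobe_zero (k : ℕ) (r c : ℝ) : weilTranslate (flatLobe k r 0) c = flatLobe k r c := by
  funext x
  simp [weilTranslate, flatLobe]

/-- `∫ f = r·M_k` for `f = flatLobe k r x₀` (`r > 0`; complex-valued integral of a real nonnegative function). [folklore] -/
theorem integral_flatLobe (hr : 0 < r) (x₀ : ℝ) : ∫ x : ℝ, flatLobe k r x₀ x = ((r * flatMass k : ℝ) : ℂ) := by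
  unfold flatLobe flatProfile
  rw [integral_complex_ofReal]
  congr 1
  have h1 : ∫ x : ℝ, (flatBump k) ((x - x₀) / r) = ∫ x : ℝ, (flatBump k) (x / r) :=
    integral_sub_right_eq_self (fun x : ℝ ↦ (flatBump k) (x / r)) x₀
  rw [h1, Measure.integral_comp_div (fun y : ℝ ↦ (flatBump k) y) r, abs_of_pos hr, smul_eq_mul]
  rfl

/-! ## §2 The cross kernel of two flat lobes at `± L/2` -/

/-- The cross kernel `k = u ⋆ h̃` of `u = flatLobe k₁ r₁ (L/2)`, `h = flatLobe k₂ r₂ (−L/2)` is a real integral: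
`k(y) = ∫ ψ₁((v − L/2)/r₁)·ψ₂((v − y + L/2)/r₂) dv`. [folklore] -/
theorem cross_flatLobe_apply (k₁ k₂ : ℕ) (r₁ r₂ L y : ℝ) :
    weilConv (flatLobe k₁ r₁ (L / 2)) (weilReflect (flatLobe k₂ r₂ (-(L / 2)))) y =
      ((∫ v : ℝ, (flatBump k₁) ((v - L / 2) / r₁) * (flatBump k₂) ((v - y - -(L / 2)) / r₂) : ℝ) : ℂ) := by
  rw [weilConv_weilReflect_eq_integral, ← integral_complex_ofReal]
  congr 1 with v
  simp only [flatLobe, flatProfile, Complex.conj_ofReal]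
  push_cast
  ring_nf

/-- The cross kernel is nonnegative. [folklore] -/
theorem cross_flatLobe_re_nonneg (k₁ k₂ : ℕ) (r₁ r₂ L y : ℝ) :
    0 ≤ (weilConv (flatLobe k₁ r₁ (L / 2)) (weilReflect (flatLobe k₂ r₂ (-(L / 2)))) y).re := by
  rw [cross_flatLobe_apply, Complex.ofReal_re]
  exact integral_nonneg fun _ ↦ mul_nonneg (flatBump k₁).nonneg (flatBump k₂).nonneg

/-- **On the window the cross kernel is constant**: for `|y − L| ≤ r₂·rIn_{k₂} − r₁` (`0 < r₁`, `0 < r₂`),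
`k(y) = r₁·M_{k₁}` — the wide lobe equals `1` wherever the narrow one lives. [this track, ATTEMPT-11 §3(e)] -/
theorem cross_flatLobe_eq_mass (hr₁ : 0 < r₁) (hr₂ : 0 < r₂) {y : ℝ} (hy : |y - L| ≤ r₂ * (flatBump k₂).rIn - r₁) :
    weilConv (flatLobe k₁ r₁ (L / 2)) (weilReflect (flatLobe k₂ r₂ (-(L / 2)))) y = ((r₁ * flatMass k₁ : ℝ) : ℂ) := by
  rw [cross_flatLobe_apply, ← integral_flatLobe (k := k₁) hr₁ (L / 2)]
  unfold flatLobe flatProfile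
  rw [integral_complex_ofReal]
  congr 1
  refine integral_congr_ae (Eventually.of_forall fun v ↦ ?_)
  simp only
  by_cases h0 : (flatBump k₁) ((v - L / 2) / r₁) = 0
  · rw [h0, zero_mul]
  · have hlt := abs_lt_rOut_of_ne_zero (flatBump k₁) h0
    rw [flatBump_rOut, abs_div, abs_of_pos hr₁, div_lt_one hr₁] at hlt
    have hone : (flatBump k₂) ((v - y - -(L / 2)) / r₂) = 1 := by
      apply (flatBump k₂).one_of_mem_closedBall
      rw [mem_closedBall, dist_zero_right, Real.norm_eq_abs, abs_div, abs_of_pos hr₂, div_le_iff₀ hr₂]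
      have : v - y - -(L / 2) = (v - L / 2) - (y - L) := by ring
      rw [this]
      calc |v - L / 2 - (y - L)| ≤ |v - L / 2| + |y - L| := abs_sub _ _
        _ ≤ r₁ + (r₂ * (flatBump k₂).rIn - r₁) := by linarith [hlt.le]
        _ = (flatBump k₂).rIn * r₂ := by ring
    rw [hone, mul_one]

/-- Off `[L − r₁ − r₂, L + r₁ + r₂]` the cross kernel vanishes (support bookkeeping). [folklore] -/
theorem cross_flatLobe_eq_zero (hr₁ : 0 < r₁) (hr₂ : 0 < r₂) {y : ℝ} (hy : y < L - r₁ - r₂ ∨ L + r₁ + r₂ < y) :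
    weilConv (flatLobe k₁ r₁ (L / 2)) (weilReflect (flatLobe k₂ r₂ (-(L / 2)))) y = 0 := by
  have hus := tsupport_flatLobe_subset (k := k₁) hr₁ (L / 2)
  have hhs := tsupport_flatLobe_subset (k := k₂) hr₂ (-(L / 2))
  rcases hy with hy | hy
  · exact weilConv_weilReflect_eq_zero_of_lt hus hhs (by linarith)
  · exact weilConv_weilReflect_eq_zero_of_gt hus hhs (by linarith)

/-- **The prime term of the cross kernel is the windowed sum**, a real series of nonnegative terms:
`Re Σ_n Λ(n)n^{−1/2}(k(log n) + k(−log n)) = Σ_n (Λ(n)/√n)·Re k(log n)` (`k(−log n) = 0`; `L > r₁ + r₂`). [folklore] -/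
theorem re_weilPrimeTerm_cross_flatLobe (hr₁ : 0 < r₁) (hr₂ : 0 < r₂) (hL : r₁ + r₂ < L) :
    (weilPrimeTerm (weilConv (flatLobe k₁ r₁ (L / 2)) (weilReflect (flatLobe k₂ r₂ (-(L / 2)))))).re =
      ∑' n : ℕ, (Λ n : ℝ) / Real.sqrt n *
        (weilConv (flatLobe k₁ r₁ (L / 2)) (weilReflect (flatLobe k₂ r₂ (-(L / 2)))) (Real.log n)).re := by
  unfold weilPrimeTerm
  have hterm : ∀ n : ℕ, ((Λ n : ℝ) : ℂ) / (Real.sqrt n : ℂ) *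
      (weilConv (flatLobe k₁ r₁ (L / 2)) (weilReflect (flatLobe k₂ r₂ (-(L / 2)))) (Real.log n) +
        weilConv (flatLobe k₁ r₁ (L / 2)) (weilReflect (flatLobe k₂ r₂ (-(L / 2)))) (-Real.log n)) =
      (((Λ n : ℝ) / Real.sqrt n *
        (weilConv (flatLobe k₁ r₁ (L / 2)) (weilReflect (flatLobe k₂ r₂ (-(L / 2)))) (Real.log n)).re : ℝ) : ℂ) := by
    intro n
    have h0 : weilConv (flatLobe k₁ r₁ (L / 2)) (weilReflect (flatLobe k₂ r₂ (-(L / 2)))) (-Real.log n) = 0 :=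
      cross_flatLobe_eq_zero hr₁ hr₂ (Or.inl (by linarith [Real.log_natCast_nonneg n]))
    rw [h0, add_zero, cross_flatLobe_apply, Complex.ofReal_re]
    push_cast
    ring
  simp only [hterm]
  rw [← Complex.ofReal_tsum, Complex.ofReal_re]

/-- Summability of the windowed series (its terms vanish for `n > e^{L + r₁ + r₂}`). [folklore] -/
theorem summable_cross_flatLobe (hr₁ : 0 < r₁) (hr₂ : 0 < r₂) :
    Summable fun n : ℕ ↦ (Λ n : ℝ) / Real.sqrt n *
      (weilConv (flatLobe k₁ r₁ (L / 2)) (weilReflect (flatLobe k₂ r₂ (-(L / 2)))) (Real.log n)).re := by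
  refine summable_of_ne_finset_zero (s := Finset.range (⌊Real.exp (L + r₁ + r₂)⌋₊ + 1)) fun n hn ↦ ?_
  rw [Finset.mem_range, not_lt] at hn
  have hn' : Real.exp (L + r₁ + r₂) < n := lt_of_lt_of_le (Nat.lt_floor_add_one _) (by exact_mod_cast hn)
  have hpos : (0 : ℝ) < n := (Real.exp_pos _).trans hn'
  have hlog : L + r₁ + r₂ < Real.log n := by rwa [Real.lt_log_iff_exp_lt hpos]
  rw [cross_flatLobe_eq_zero hr₁ hr₂ (Or.inr hlog), Complex.zero_re, mul_zero]

/-- **The window lower bound**: `r₁M_{k₁}·Σ_{n∈T} Λ(n)/√n ≤ Re prime(k)` for every finite `T` inside the flat window. [this track] -/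
theorem mass_mul_sum_le_re_weilPrimeTerm (hr₁ : 0 < r₁) (hr₂ : 0 < r₂) (hL : r₁ + r₂ < L) (T : Finset ℕ)
    (hT : ∀ n ∈ T, |Real.log n - L| ≤ r₂ * (flatBump k₂).rIn - r₁) :
    r₁ * flatMass k₁ * ∑ n ∈ T, (Λ n : ℝ) / Real.sqrt n ≤
      (weilPrimeTerm (weilConv (flatLobe k₁ r₁ (L / 2)) (weilReflect (flatLobe k₂ r₂ (-(L / 2)))))).re := by
  rw [re_weilPrimeTerm_cross_flatLobe hr₁ hr₂ hL]
  have hnn : ∀ n : ℕ, 0 ≤ (Λ n : ℝ) / Real.sqrt n *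
      (weilConv (flatLobe k₁ r₁ (L / 2)) (weilReflect (flatLobe k₂ r₂ (-(L / 2)))) (Real.log n)).re :=
    fun n ↦ mul_nonneg (div_nonneg ArithmeticFunction.vonMangoldt_nonneg (Real.sqrt_nonneg _))
      (cross_flatLobe_re_nonneg k₁ k₂ r₁ r₂ L _)
  refine le_trans ?_ ((summable_cross_flatLobe hr₁ hr₂).sum_le_tsum T fun n _ ↦ hnn n)
  rw [Finset.mul_sum]
  refine Finset.sum_le_sum fun n hn ↦ ?_
  rw [cross_flatLobe_eq_mass hr₁ hr₂ (hT n hn), Complex.ofReal_re]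
  ring_nf
  rfl

/-! ## §3 The polar and archimedean terms of the cross kernel -/

/-- **Polar term**: `‖k̂(0) + k̂(1)‖ ≤ (e^{L/2} + e^{−L/2})·4r₁r₂·e^{r₁/2}e^{r₂/2}` (`k̂(s) = û(s)·conj ĥ(1 − s̄)`, the lobes' transforms at
`0, 1` carry `e^{∓L/4}`). [folklore] -/
theorem norm_weilPolarTerm_cross_flatLobe_le (hr₁ : 0 < r₁) (hr₂ : 0 < r₂) (L : ℝ) :
    ‖weilPolarTerm (weilConv (flatLobe k₁ r₁ (L / 2)) (weilReflect (flatLobe k₂ r₂ (-(L / 2)))))‖ ≤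
      (Real.exp (L / 2) + Real.exp (-(L / 2))) * (4 * r₁ * r₂ * (Real.exp (r₁ / 2) * Real.exp (r₂ / 2))) := by
  have hu := isWeilTest_flatLobe (k := k₁) hr₁ (L / 2)
  have hh := isWeilTest_flatLobe (k := k₂) hr₂ (-(L / 2))
  unfold weilPolarTerm
  rw [weilMellin_weilConv_holds hu.1.continuous hu.2 hh.weilReflect.1.continuous hh.weilReflect.2,
    weilMellin_weilConv_holds hu.1.continuous hu.2 hh.weilReflect.1.continuous hh.weilReflect.2,
    weilMellin_weilReflect_holds, weilMellin_weilReflect_holds,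
    show (1 : ℂ) - conj (0 : ℂ) = 1 by simp, show (1 : ℂ) - conj (1 : ℂ) = 0 by simp]
  have h1 := norm_weilMellin_flatLobe_le (k := k₁) hr₁ (L / 2) 0
  have h2 := norm_weilMellin_flatLobe_le (k := k₂) hr₂ (-(L / 2)) 1
  have h3 := norm_weilMellin_flatLobe_le (k := k₁) hr₁ (L / 2) 1
  have h4 := norm_weilMellin_flatLobe_le (k := k₂) hr₂ (-(L / 2)) 0
  simp only [Complex.zero_re, Complex.one_re] at h1 h2 h3 h4
  rw [show |(0 : ℝ) - 1 / 2| = 1 / 2 by norm_num] at h1 h4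
  rw [show |(1 : ℝ) - 1 / 2| = 1 / 2 by norm_num] at h2 h3
  have e1 : Real.exp ((0 - 1 / 2) * (L / 2)) * Real.exp ((1 - 1 / 2) * -(L / 2)) = Real.exp (-(L / 2)) := by
    rw [← Real.exp_add]; ring_nf
  have e2 : Real.exp ((1 - 1 / 2) * (L / 2)) * Real.exp ((0 - 1 / 2) * -(L / 2)) = Real.exp (L / 2) := by
    rw [← Real.exp_add]; ring_nf
  have n0 : 0 ≤ ‖weilMellin (flatLobe k₁ r₁ (L / 2)) 0‖ := norm_nonneg _
  have n1 : 0 ≤ ‖weilMellin (flatLobe k₂ r₂ (-(L / 2))) 1‖ := norm_nonneg _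
  have n2 : 0 ≤ ‖weilMellin (flatLobe k₁ r₁ (L / 2)) 1‖ := norm_nonneg _
  have n3 : 0 ≤ ‖weilMellin (flatLobe k₂ r₂ (-(L / 2))) 0‖ := norm_nonneg _
  have hA : ‖weilMellin (flatLobe k₁ r₁ (L / 2)) 0 * conj (weilMellin (flatLobe k₂ r₂ (-(L / 2))) 1)‖ ≤
      Real.exp (-(L / 2)) * (4 * r₁ * r₂ * (Real.exp (r₁ / 2) * Real.exp (r₂ / 2))) := by
    rw [norm_mul, Complex.norm_conj]
    calc _ ≤ (Real.exp ((0 - 1 / 2) * (L / 2)) * (2 * r₁ * Real.exp (r₁ * (1 / 2)))) *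
          (Real.exp ((1 - 1 / 2) * -(L / 2)) * (2 * r₂ * Real.exp (r₂ * (1 / 2)))) :=
          mul_le_mul h1 h2 n1 (by positivity)
      _ = _ := by rw [← e1]; ring_nf
  have hB : ‖weilMellin (flatLobe k₁ r₁ (L / 2)) 1 * conj (weilMellin (flatLobe k₂ r₂ (-(L / 2))) 0)‖ ≤
      Real.exp (L / 2) * (4 * r₁ * r₂ * (Real.exp (r₁ / 2) * Real.exp (r₂ / 2))) := by
    rw [norm_mul, Complex.norm_conj]
    calc _ ≤ (Real.exp ((1 - 1 / 2) * (L / 2)) * (2 * r₁ * Real.exp (r₁ * (1 / 2)))) *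
          (Real.exp ((0 - 1 / 2) * -(L / 2)) * (2 * r₂ * Real.exp (r₂ * (1 / 2)))) :=
          mul_le_mul h3 h4 n3 (by positivity)
      _ = _ := by rw [← e2]; ring_nf
  calc _ ≤ ‖weilMellin (flatLobe k₁ r₁ (L / 2)) 0 * conj (weilMellin (flatLobe k₂ r₂ (-(L / 2))) 1)‖ +
        ‖weilMellin (flatLobe k₁ r₁ (L / 2)) 1 * conj (weilMellin (flatLobe k₂ r₂ (-(L / 2))) 0)‖ := norm_add_le _ _
    _ ≤ _ := by nlinarith [hA, hB]

/-- **Archimedean term**: `‖W_∞(k)‖ ≤ 4r₂·M(L/2 − r₂)·(r₁N₁ + r₂N₂)` (`r₁ ≤ r₂ < L/2`; separated supports). [folklore] -/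
theorem norm_weilArchTerm_cross_flatLobe_le (hr₁ : 0 < r₁) (h12 : r₁ ≤ r₂) (hL : 2 * r₂ < L) :
    ‖weilArchTerm (weilConv (flatLobe k₁ r₁ (L / 2)) (weilReflect (flatLobe k₂ r₂ (-(L / 2)))))‖ ≤
      4 * r₂ * archGapBound (L / 2 - r₂) *
        (r₁ * weilNorm2Sq (flatProfile k₁) + r₂ * weilNorm2Sq (flatProfile k₂)) := by
  have hr₂ : 0 < r₂ := lt_of_lt_of_le hr₁ h12
  have hu := isWeilTest_flatLobe (k := k₁) hr₁ (L / 2)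
  have hh := isWeilTest_flatLobe (k := k₂) hr₂ (-(L / 2))
  have hus : tsupport (flatLobe k₁ r₁ (L / 2)) ⊆ Icc (L / 2 - r₂) (L / 2 + r₂) :=
    (tsupport_flatLobe_subset (k := k₁) hr₁ (L / 2)).trans (Icc_subset_Icc (by linarith) (by linarith))
  have hhs : tsupport (flatLobe k₂ r₂ (-(L / 2))) ⊆ Icc (-(L / 2 + r₂)) (-(L / 2 - r₂)) :=
    (tsupport_flatLobe_subset (k := k₂) hr₂ (-(L / 2))).trans (Icc_subset_Icc (by linarith) (by linarith))
  have h := norm_weilArchTerm_cross_le hu hh (c' := L / 2 - r₂) (b := L / 2 + r₂) (by linarith) (by linarith) hus hhs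
  rw [integral_norm_sq_flatLobe hr₁, integral_norm_sq_flatLobe hr₂] at h
  calc _ ≤ _ := h
    _ = _ := by ring

/-! ## §4 Assembly -/

/-- **The cross term is Weil's functional of the cross kernel**: `crossRe(u, h) = Re W(u ⋆ h̃)` (`h ⋆ ũ = (u ⋆ h̃)~` and
`Re W(k̃) = Re W(k)`). [cite: Bombieri2000Weil, §§2–3] -/
theorem crossRe_eq_re_weilFunctional {u h : ℝ → ℂ} (hu : IsWeilTest u) (hh : IsWeilTest h) :
    crossRe u h = (weilFunctional (weilConv u (weilReflect h))).re := by
  have h2 := two_mul_crossRe hu hh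
  rw [← GroundStatesConvergeToXi.weilReflect_weilConv_weilReflect u h, Complex.add_re, WeilBochner.re_weilFunctional_weilReflect] at h2
  linarith

/-- **SHARP WINDOW INEQUALITY (two flat lobes).** For `0 < r₁ ≤ r₂ ≤ 1/4`, `2r₂ < L`, `τ > 0`, Weil positivity on `C(L/2 + r₂)`, and any
finite `T ⊆ {n : |log n − L| ≤ r₂(1 − 1/(k₂+2)) − r₁}`:
`r₁M_{k₁}·Σ_{n∈T} Λ(n)/√n ≤ (e^{L/2} + e^{−L/2})·4r₁r₂e^{r₁/2}e^{r₂/2} + 4r₂M(L/2 − r₂)(r₁N₁ + r₂N₂) + (ℓ₁r₁N₁ + τ²ℓ₂r₂N₂)/(2τ)`,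
`ℓᵢ = log(1/rᵢ) + flatEnergyConst kᵢ`, `Nᵢ = weilNorm2Sq (flatProfile kᵢ)`. Mechanism: `0 ≤ Re Q(u ± τh) = Re Q(u) ± 2τ·crossRe + τ²Re Q(h)`,
`crossRe = Re W(u⋆h̃) = Re polar − Re prime + Re arch`, the flat-lobe energy ceilings, and §2–§3. [this track, ATTEMPT-11 §3(e)] -/
theorem sharp_window_sum_le (k₁ k₂ : ℕ) (hr₁ : 0 < r₁) (h12 : r₁ ≤ r₂) (hr₂ : r₂ ≤ 1 / 4) (hL : 2 * r₂ < L)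
    (hW : WeilPositivityOn (L / 2 + r₂)) {τ : ℝ} (hτ : 0 < τ) (T : Finset ℕ)
    (hT : ∀ n ∈ T, |Real.log n - L| ≤ r₂ * (flatBump k₂).rIn - r₁) :
    r₁ * flatMass k₁ * ∑ n ∈ T, (Λ n : ℝ) / Real.sqrt n ≤
      (Real.exp (L / 2) + Real.exp (-(L / 2))) * (4 * r₁ * r₂ * (Real.exp (r₁ / 2) * Real.exp (r₂ / 2))) +
        4 * r₂ * archGapBound (L / 2 - r₂) *
          (r₁ * weilNorm2Sq (flatProfile k₁) + r₂ * weilNorm2Sq (flatProfile k₂)) +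
        ((Real.log (1 / r₁) + flatEnergyConst k₁) * (r₁ * weilNorm2Sq (flatProfile k₁)) +
            τ ^ 2 * ((Real.log (1 / r₂) + flatEnergyConst k₂) * (r₂ * weilNorm2Sq (flatProfile k₂)))) / (2 * τ) := by
  have hr₂0 : 0 < r₂ := lt_of_lt_of_le hr₁ h12
  have hr₁4 : r₁ ≤ 1 / 4 := h12.trans hr₂
  set u := flatLobe k₁ r₁ (L / 2) with hu_def
  set h := flatLobe k₂ r₂ (-(L / 2)) with hh_def
  have hu : IsWeilTest u := isWeilTest_flatLobe hr₁ _
  have hh : IsWeilTest h := isWeilTest_flatLobe hr₂0 _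
  -- support of `u + t•h`
  have hsupp : ∀ t : ℝ, tsupport (u + fun x ↦ (t : ℂ) * h x) ⊆ Icc (-(L / 2 + r₂)) (L / 2 + r₂) := by
    intro t
    have h1 : tsupport u ⊆ Icc (-(L / 2 + r₂)) (L / 2 + r₂) :=
      (tsupport_flatLobe_subset (k := k₁) hr₁ (L / 2)).trans (Icc_subset_Icc (by linarith) (by linarith))
    have h2 : tsupport (fun x ↦ (t : ℂ) * h x) ⊆ Icc (-(L / 2 + r₂)) (L / 2 + r₂) :=
      (tsupport_mul_subset_right (f := fun _ : ℝ ↦ (t : ℂ)) (g := h)).trans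
        ((tsupport_flatLobe_subset (k := k₂) hr₂0 (-(L / 2))).trans (Icc_subset_Icc (by linarith) (by linarith)))
    exact (tsupport_add u (fun x ↦ (t : ℂ) * h x)).trans (union_subset h1 h2)
  have hpos : ∀ t : ℝ, 0 ≤ (weilQuadratic (u + fun x ↦ (t : ℂ) * h x)).re := fun t ↦
    hW _ (hu.add (hh.const_mul (t : ℂ))) (hsupp t)
  have hp := hpos τ
  have hm := hpos (-τ)
  rw [re_weilQuadratic_add_real_mul hu hh] at hp hm
  -- energy ceilings
  have hQu := re_weilQuadratic_flatLobe_le (k := k₁) hr₁ hr₁4 (L / 2)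
  have hQh := re_weilQuadratic_flatLobe_le (k := k₂) hr₂0 hr₂ (-(L / 2))
  rw [integral_norm_sq_flatLobe hr₁] at hQu
  rw [integral_norm_sq_flatLobe hr₂0] at hQh
  -- the cross term
  have hX : crossRe u h = (weilFunctional (weilConv u (weilReflect h))).re := crossRe_eq_re_weilFunctional hu hh
  have hW3 : (weilFunctional (weilConv u (weilReflect h))).re =
      (weilPolarTerm (weilConv u (weilReflect h))).re - (weilPrimeTerm (weilConv u (weilReflect h))).re +
        (weilArchTerm (weilConv u (weilReflect h))).re := by
    unfold weilFunctional; rw [Complex.add_re, Complex.sub_re]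
  have hS := mass_mul_sum_le_re_weilPrimeTerm (k₁ := k₁) (k₂ := k₂) hr₁ hr₂0 (by linarith) T hT
  have hP := (Complex.re_le_norm _).trans (norm_weilPolarTerm_cross_flatLobe_le (k₁ := k₁) (k₂ := k₂) hr₁ hr₂0 L)
  have hA := (Complex.re_le_norm _).trans (norm_weilArchTerm_cross_flatLobe_le (k₁ := k₁) (k₂ := k₂) hr₁ h12 hL)
  -- |X| ≤ (Q_u + τ² Q_h)/(2τ) ≤ (ceilings)/(2τ)
  have hτ2 := mul_le_mul_of_nonneg_left hQh (sq_nonneg τ)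
  have hneg : -crossRe u h * (2 * τ) ≤
      (Real.log (1 / r₁) + flatEnergyConst k₁) * (r₁ * weilNorm2Sq (flatProfile k₁)) +
        τ ^ 2 * ((Real.log (1 / r₂) + flatEnergyConst k₂) * (r₂ * weilNorm2Sq (flatProfile k₂))) := by
    have e : (weilQuadratic h).re * (-τ) ^ 2 = τ ^ 2 * (weilQuadratic h).re := by ring
    rw [e] at hm
    linarith [hm, hQu, hτ2]
  have hdiv : -crossRe u h ≤
      ((Real.log (1 / r₁) + flatEnergyConst k₁) * (r₁ * weilNorm2Sq (flatProfile k₁)) +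
        τ ^ 2 * ((Real.log (1 / r₂) + flatEnergyConst k₂) * (r₂ * weilNorm2Sq (flatProfile k₂)))) / (2 * τ) := by
    rw [le_div_iff₀ (by positivity)]
    exact hneg
  have hprime : (weilPrimeTerm (weilConv u (weilReflect h))).re =
      (weilPolarTerm (weilConv u (weilReflect h))).re + (weilArchTerm (weilConv u (weilReflect h))).re - crossRe u h := by
    linarith [hW3, hX]
  linarith [hS, hP, hA, hdiv, hprime]

/-- **SHARP WINDOW INEQUALITY, numbers in** (`r₁ = δ²r₂`, `τ = δ`, `N ≤ 2`, `M(c′) ≤ 1.27` once `L ≥ 2r₂ + 1/2`): for `0 < δ ≤ 1`,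
`0 < r₂ ≤ 1/4`, Weil positivity on `C(L/2 + r₂)` and any finite `T ⊆ {n : |log n − L| ≤ r₂(1 − 1/(k₂+2)) − δ²r₂}`,
`M_{k₁}·Σ_{n∈T} Λ(n)/√n ≤ (e^{L/2} + e^{−L/2})·4r₂·e^{δ²r₂/2}e^{r₂/2} + 10.16·r₂(1 + 1/δ²) + (ℓ₁ + ℓ₂)/δ`,
`ℓ₁ = log(1/(δ²r₂)) + C_{k₁}`, `ℓ₂ = log(1/r₂) + C_{k₂}`, `M_{k₁} = flatMass k₁ ≥ 2 − 2/(k₁+2)`. The expected size of the left sum on this window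
(half-width `w = r₂(1 − 1/(k₂+2) − δ²)`) is `(e^{L/2} + e^{−L/2})·2w·(1 + O(r₂))`, so the Brun–Titchmarsh constant is
`(k₁+2)/((k₁+1)(1 − 1/(k₂+2) − δ²))·e^{r₂} → 1`, with fluctuation `(ℓ₁ + ℓ₂)/(δM_{k₁}) ≍ δ^{−1}·log(1/r₂)` (`≍ √x·δ^{−1}log(x/h)` in
`Λ`-units). [this track, ATTEMPT-11 §3(e)] -/
theorem sharp_window_sum_le' (k₁ k₂ : ℕ) {δ : ℝ} (hδ : 0 < δ) (hδ1 : δ ≤ 1) (hr₂ : 0 < r₂) (hr₂4 : r₂ ≤ 1 / 4)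
    (hL : 2 * r₂ + 1 / 2 ≤ L) (hW : WeilPositivityOn (L / 2 + r₂)) (T : Finset ℕ)
    (hT : ∀ n ∈ T, |Real.log n - L| ≤ r₂ * (flatBump k₂).rIn - δ ^ 2 * r₂) :
    flatMass k₁ * ∑ n ∈ T, (Λ n : ℝ) / Real.sqrt n ≤
      (Real.exp (L / 2) + Real.exp (-(L / 2))) * (4 * r₂ * (Real.exp (δ ^ 2 * r₂ / 2) * Real.exp (r₂ / 2))) +
        10.16 * r₂ * (1 + 1 / δ ^ 2) +
        ((Real.log (1 / (δ ^ 2 * r₂)) + flatEnergyConst k₁) + (Real.log (1 / r₂) + flatEnergyConst k₂)) / δ := by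
  have hδ2 : 0 < δ ^ 2 := by positivity
  have hr₁ : 0 < δ ^ 2 * r₂ := by positivity
  have hd1 : δ ^ 2 ≤ 1 := pow_le_one₀ hδ.le hδ1
  have h12 : δ ^ 2 * r₂ ≤ r₂ := by nlinarith
  have h := sharp_window_sum_le k₁ k₂ hr₁ h12 hr₂4 (by linarith) hW hδ T hT
  set S := ∑ n ∈ T, (Λ n : ℝ) / Real.sqrt n with hS
  set N₁ := weilNorm2Sq (flatProfile k₁)
  set N₂ := weilNorm2Sq (flatProfile k₂)
  set ℓ₁ := Real.log (1 / (δ ^ 2 * r₂)) + flatEnergyConst k₁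
  set ℓ₂ := Real.log (1 / r₂) + flatEnergyConst k₂
  set A := archGapBound (L / 2 - r₂)
  have hN₁ : N₁ ≤ 2 := weilNorm2Sq_flatProfile_le_two k₁
  have hN₂ : N₂ ≤ 2 := weilNorm2Sq_flatProfile_le_two k₂
  have hN₁' : 1 ≤ N₁ := one_le_weilNorm2Sq_flatProfile k₁
  have hN₂' : 1 ≤ N₂ := one_le_weilNorm2Sq_flatProfile k₂
  have hA : A ≤ 1.27 := archGapBound_le (by linarith)
  have hA0 : 0 < A := archGapBound_pos (by linarith)
  have hℓ₁ : 0 ≤ ℓ₁ := by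
    have : 0 ≤ Real.log (1 / (δ ^ 2 * r₂)) := Real.log_nonneg (by rw [le_div_iff₀ hr₁]; nlinarith)
    linarith [six_le_flatEnergyConst k₁]
  have hℓ₂ : 0 ≤ ℓ₂ := by
    have : 0 ≤ Real.log (1 / r₂) := Real.log_nonneg (by rw [le_div_iff₀ hr₂]; linarith)
    linarith [six_le_flatEnergyConst k₂]
  have hS0 : 0 ≤ S := Finset.sum_nonneg fun n _ ↦ div_nonneg ArithmeticFunction.vonMangoldt_nonneg (Real.sqrt_nonneg _)
  -- the three terms, each bounded by `δ²r₂ ·(its displayed share)`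
  have hT2 : 4 * r₂ * A * (δ ^ 2 * r₂ * N₁ + r₂ * N₂) ≤ δ ^ 2 * r₂ * (10.16 * r₂ * (1 + 1 / δ ^ 2)) := by
    have e : δ ^ 2 * r₂ * (10.16 * r₂ * (1 + 1 / δ ^ 2)) = 10.16 * r₂ * r₂ * (δ ^ 2 + 1) := by
      have hinv : δ ^ 2 * (1 / δ ^ 2) = 1 := mul_one_div_cancel hδ2.ne'
      linear_combination (10.16 * r₂ * r₂) * hinv
    rw [e]
    have h1 : δ ^ 2 * r₂ * N₁ + r₂ * N₂ ≤ 2 * r₂ * (δ ^ 2 + 1) := by nlinarith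
    calc 4 * r₂ * A * (δ ^ 2 * r₂ * N₁ + r₂ * N₂) ≤ 4 * r₂ * 1.27 * (2 * r₂ * (δ ^ 2 + 1)) :=
          mul_le_mul (by nlinarith) h1 (by positivity) (by positivity)
      _ = 10.16 * r₂ * r₂ * (δ ^ 2 + 1) := by ring
  have hT3 : (ℓ₁ * (δ ^ 2 * r₂ * N₁) + δ ^ 2 * (ℓ₂ * (r₂ * N₂))) / (2 * δ) ≤ δ ^ 2 * r₂ * ((ℓ₁ + ℓ₂) / δ) := by
    have hinv1 : δ⁻¹ * δ = 1 := inv_mul_cancel₀ hδ.ne'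
    rw [div_le_iff₀ (by positivity), show δ ^ 2 * r₂ * ((ℓ₁ + ℓ₂) / δ) * (2 * δ) = 2 * (δ ^ 2 * r₂) * (ℓ₁ + ℓ₂) by
      linear_combination (2 * δ ^ 2 * r₂ * (ℓ₁ + ℓ₂)) * hinv1]
    have h1 : ℓ₁ * (δ ^ 2 * r₂ * N₁) ≤ 2 * (δ ^ 2 * r₂) * ℓ₁ := by nlinarith [mul_nonneg hℓ₁ hr₁.le]
    have h2 : δ ^ 2 * (ℓ₂ * (r₂ * N₂)) ≤ 2 * (δ ^ 2 * r₂) * ℓ₂ := by nlinarith [mul_nonneg hℓ₂ hr₁.le]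
    linarith
  have hT1 : (Real.exp (L / 2) + Real.exp (-(L / 2))) * (4 * (δ ^ 2 * r₂) * r₂ * (Real.exp (δ ^ 2 * r₂ / 2) * Real.exp (r₂ / 2))) =
      δ ^ 2 * r₂ * ((Real.exp (L / 2) + Real.exp (-(L / 2))) * (4 * r₂ * (Real.exp (δ ^ 2 * r₂ / 2) * Real.exp (r₂ / 2)))) := by
    ring
  have key : δ ^ 2 * r₂ * (flatMass k₁ * S) ≤ δ ^ 2 * r₂ *
      ((Real.exp (L / 2) + Real.exp (-(L / 2))) * (4 * r₂ * (Real.exp (δ ^ 2 * r₂ / 2) * Real.exp (r₂ / 2))) +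
        10.16 * r₂ * (1 + 1 / δ ^ 2) + (ℓ₁ + ℓ₂) / δ) := by
    have : δ ^ 2 * r₂ * flatMass k₁ * S = δ ^ 2 * r₂ * (flatMass k₁ * S) := by ring
    rw [← this]
    linarith [h, hT1, hT2, hT3]
  exact le_of_mul_le_mul_left key hr₁

end Summit.RiemannHypothesis.RiemannHypothesis.Theorems.HandoffPrimeShadow

end
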